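import Literature.NumberTheory.EllipticCurves.PAdicMeasureTransform
import Literature.NumberTheory.EllipticCurves.PAdicLFunctionFunctionalEquationProofs
import HarnessLib

/-!
# The `p`-adic Mellin transform of a TRANSLATED distribution: `L[ν(z·)] = (1 + T)^{−c} · L[ν]`
# (`⟨z⟩ = γ^{c}`), for an abstract bounded distribution on `ℤ_p` (PROOFS ONLY)

Companion of `Literature.NumberTheory.EllipticCurves.PAdicMeasureTransform` (the transform of an abstract bounded
distribution `ν : (n : ℕ) → ZMod (pⁿ) → ℚ_p`, Mazur–Tate–Teitelbaum §I.11–I.13) and of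
`PAdicLFunctionFunctionalEquationProofs` (the same coefficientwise technique for the involution `x ↦ −1/(Nx)`). For a unit
`z ∈ ℤ_pˣ` written `z ≡ η_z γ^{c}` (`η_z` Teichmüller, `c ∈ ℤ_p`; for `z = ℓ` a natural prime to `p` this is
`exists_teichmuller_exponent_natCast`), the translated distribution `ν_z(a + pⁿℤ_p) = ν(z·a + pⁿℤ_p)` has Riemann sums
`RS_z(k, n) = ∑_{η,s} ν(z·ηγˢ) (s choose k) = ∑_{η,s} ν(ηγˢ) ((s − c̄) choose k)` (`finsum_sum_classes_translate`, `c̄ = c mod pⁿ`), and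
since `x ↦ (x choose k)` is `p`-adically Lipschitz (`norm_choose_sub_choose_le_of_sub_mem_span`) and
`∑_{i} (−c choose k−i)(s choose i) = ((−c + s) choose k)` (Vandermonde, `sum_range_choose_mul_natChoose`), the limits satisfy
**`limUnder_riemannSum_translate`**: `lim_n RS_z(k, n) = ∑_{i ≤ k} (−c choose k − i) · lim_n RS(i, n)`, i.e. the transform of
`ν_z` is `(1 + T)^{−c} ·` the transform of `ν` (`(1+T)^{−c} = PowerSeries.binomialSeries ℚ_p (−c)`;
`coeff_C_mul_binomialSeries_mul`) — Matsuno 2000's "`t(ℓx) = t(ℓ) + t(x)`" step in the proof of Lemma 3.3 (J. Number Theory 84,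
p. 88). USE (cell bsd-2adic, seat conv-1, RC-159 road P2e): with `PAdicLFunctionTameUnitLevelChangeProofs.weighted_msdMeasureTame_levelChange`
it gives `L_p(f, α, 𝟙_{mℓ}) = (a_ℓ − (1+T)^{c_ℓ} − (1+T)^{−c_ℓ}) · L_p(f, α, 𝟙_m)`.

References: B. Mazur, J. Tate, J. Teitelbaum, Invent. Math. 84 (1986), §I.11–I.13 (pp. 13–19) [MazurTateTeitelbaum1986Invent];
K. Matsuno, J. Number Theory 84 (2000), Lemma 3.3 (pp. 87–88) [Matsuno2000]; L. Washington, GTM 83, §5.1, §7.2 [Washington1997].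
-/

noncomputable section

open Filter Topology PowerSeries

namespace Literature.NumberTheory.EllipticCurves

variable {p : ℕ} [Fact p.Prime]

/-! ### Reindexing a Riemann sum along a translation -/

/-- **Reindexing along `u ↦ z·u`.** For a class `z = η_z γ^{s_z}` modulo `p^{n+e₀}`, a weight `w` and `g : ℤ/pⁿ → R`,
`∑_{η,s} w(z · ηγˢ) g(s) = ∑_{η,s} w(ηγˢ) g(s − s_z)`: `(η, s) ↦ (η_z η, s_z + s)` is a bijection of `μ_τ × ℤ/pⁿ` with
`(η_z η) γ^{s_z + s} = z · ηγˢ` (`classMap_mul`) — the substitution `x ↦ z x`, `ℓ(zx) = ℓ(z) + ℓ(x)`, in the Riemann sums of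
`∫ g(ℓ(x)) dν` (Matsuno 2000, proof of Lemma 3.3). [cite: Matsuno2000, Lemma 3.3 (pp. 87–88), proof] [cite: MazurTateTeitelbaum1986Invent, §I.13 (pp. 18–19)] -/
theorem finsum_sum_classes_translate {R : Type*} [CommRing R] (n : ℕ)
    (w : ZMod (p ^ (n + cyclotomicExponent p)) → R) (ηz : rootsOfUnity (torsionOrder p) ℤ_[p]) (sz : ZMod (p ^ n))
    (g : ZMod (p ^ n) → R) :
    ∑ᶠ η : rootsOfUnity (torsionOrder p) ℤ_[p], ∑ s : ZMod (p ^ n),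
        w ((PadicInt.toZModPow (n + cyclotomicExponent p) ((ηz : ℤ_[p]ˣ) : ℤ_[p]) *
            (cyclotomicGenerator p : ZMod (p ^ (n + cyclotomicExponent p))) ^ sz.val) *
          (PadicInt.toZModPow (n + cyclotomicExponent p) ((η : ℤ_[p]ˣ) : ℤ_[p]) *
            (cyclotomicGenerator p : ZMod (p ^ (n + cyclotomicExponent p))) ^ s.val)) * g s =
      ∑ᶠ η : rootsOfUnity (torsionOrder p) ℤ_[p], ∑ s : ZMod (p ^ n),
        w (PadicInt.toZModPow (n + cyclotomicExponent p) ((η : ℤ_[p]ˣ) : ℤ_[p]) *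
            (cyclotomicGenerator p : ZMod (p ^ (n + cyclotomicExponent p))) ^ s.val) * g (s - sz) := by
  classical
  haveI := neZero_torsionOrder p
  haveI := Fintype.ofFinite (rootsOfUnity (torsionOrder p) ℤ_[p])
  haveI : NeZero (p ^ n) := ⟨pow_ne_zero _ (Fact.out : p.Prime).ne_zero⟩
  rw [finsum_eq_sum_of_fintype, finsum_eq_sum_of_fintype, ← Fintype.sum_prod_type', ← Fintype.sum_prod_type']
  -- translation `(η, s) ↦ (η_z η, s_z + s)` on the pairs
  set τ : rootsOfUnity (torsionOrder p) ℤ_[p] × ZMod (p ^ n) → rootsOfUnity (torsionOrder p) ℤ_[p] × ZMod (p ^ n) :=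
    fun x ↦ (ηz * x.1, sz + x.2) with hτ
  have hτbij : Function.Bijective τ := by
    refine ⟨fun x y h => ?_, fun y => ⟨(ηz⁻¹ * y.1, y.2 - sz), ?_⟩⟩
    · simp only [hτ, Prod.mk.injEq] at h
      exact Prod.ext (mul_left_cancel h.1) (add_left_cancel h.2)
    · simp only [hτ]
      ext1
      · dsimp only; rw [mul_inv_cancel_left]
      · dsimp only; rw [add_sub_cancel]
  refine Fintype.sum_bijective τ hτbij _ _ fun x ↦ ?_
  -- `Φ(τ x) = z · Φ(x)` and `(τ x).2 − s_z = x.2`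
  simp only [hτ]
  rw [classMap_mul p n ηz x.1 sz x.2, add_sub_cancel_left]

/-! ### The transform of a translated distribution -/

/-- The exponent bookkeeping: `((s − c̄).val : ℤ_p) − (−c + s.val) ∈ pⁿℤ_p` (`c̄ = c mod pⁿ`, representatives in `[0, pⁿ)`).
[folklore] -/
private theorem val_sub_sub_mem_span (c : ℤ_[p]) (n : ℕ) (s : ZMod (p ^ n)) :
    ((s - PadicInt.toZModPow n c).val : ℤ_[p]) - (-c + (s.val : ℤ_[p])) ∈ Ideal.span {(p : ℤ_[p]) ^ n} := by
  haveI : NeZero (p ^ n) := ⟨pow_ne_zero _ (Fact.out : p.Prime).ne_zero⟩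
  rw [← PadicInt.ker_toZModPow, RingHom.mem_ker, map_sub, map_add, map_neg, map_natCast, map_natCast,
    ZMod.natCast_zmod_val, ZMod.natCast_zmod_val]
  ring

/-- **The transform of a translated distribution is `(1+T)^{−c}` times the transform** (Matsuno 2000, the substitution
`x ↦ ℓx` in the proof of Lemma 3.3; Mazur–Tate–Teitelbaum §I.13), coefficientwise: let `ν` be a distribution on `ℤ_p` with the
fibre relation and `‖ν‖ ≤ C`, `RS(k, n) = ∑_{η,s} ν(ηγˢ + p^{n+e₀}) (s choose k)` its Riemann sums and
`RS_z(k, n) = ∑_{η,s} ν(z_n · ηγˢ + p^{n+e₀}) (s choose k)` those of the translate by a compatible family of classes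
`z_n = η_z γ^{c mod pⁿ}` (`c ∈ ℤ_p`); then `RS_z(k, ·)` converges and
`lim_n RS_z(k, n) = ∑_{i ≤ k} (−c choose k−i) · lim_n RS(i, n)` — the `k`-th coefficient of
`(1+T)^{−c} · ∑_i (lim RS(i,·)) T^i` (`coeff_C_mul_binomialSeries_mul`).
[cite: Matsuno2000, Lemma 3.3 (pp. 87–88), proof] [cite: MazurTateTeitelbaum1986Invent, §I.13 (pp. 18–19)] -/
theorem tendsto_riemannSum_translate {ν : (n : ℕ) → ZMod (p ^ n) → ℚ_[p]}
    (hdist : ∀ (n : ℕ) (a : ZMod (p ^ n)),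
      ∑ b ∈ Finset.univ.filter (fun b : ZMod (p ^ (n + 1)) ↦
        ZMod.castHom (pow_dvd_pow p n.le_succ) (ZMod (p ^ n)) b = a), ν (n + 1) b = ν n a)
    {C : ℝ} (hC : ∀ (n : ℕ) (a : ZMod (p ^ n)), ‖ν n a‖ ≤ C)
    {RS RSz : ℕ → ℕ → ℚ_[p]}
    (hRS : ∀ k n : ℕ, RS k n =
      ∑ᶠ η : rootsOfUnity (torsionOrder p) ℤ_[p], ∑ s : ZMod (p ^ n),
        ν (n + cyclotomicExponent p)
            (PadicInt.toZModPow (n + cyclotomicExponent p) ((η : ℤ_[p]ˣ) : ℤ_[p]) *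
              (cyclotomicGenerator p : ZMod (p ^ (n + cyclotomicExponent p))) ^ s.val) *
          ((s.val.choose k : ℕ) : ℚ_[p]))
    {ηz : rootsOfUnity (torsionOrder p) ℤ_[p]} {c : ℤ_[p]}
    (hRSz : ∀ k n : ℕ, RSz k n =
      ∑ᶠ η : rootsOfUnity (torsionOrder p) ℤ_[p], ∑ s : ZMod (p ^ n),
        ν (n + cyclotomicExponent p)
            ((PadicInt.toZModPow (n + cyclotomicExponent p) ((ηz : ℤ_[p]ˣ) : ℤ_[p]) *
              (cyclotomicGenerator p : ZMod (p ^ (n + cyclotomicExponent p))) ^ (PadicInt.toZModPow n c).val) *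
            (PadicInt.toZModPow (n + cyclotomicExponent p) ((η : ℤ_[p]ˣ) : ℤ_[p]) *
              (cyclotomicGenerator p : ZMod (p ^ (n + cyclotomicExponent p))) ^ s.val)) *
          ((s.val.choose k : ℕ) : ℚ_[p]))
    (k : ℕ) :
    Tendsto (fun n ↦ RSz k n) atTop
      (𝓝 (∑ i ∈ Finset.range (k + 1), algebraMap ℤ_[p] ℚ_[p] (Ring.choose (-c) (k - i)) *
        limUnder atTop (fun n ↦ RS i n))) := by
  classical
  haveI := neZero_torsionOrder p
  haveI := Fintype.ofFinite (rootsOfUnity (torsionOrder p) ℤ_[p])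
  have hC0 : 0 ≤ C := (norm_nonneg _).trans (hC 0 0)
  -- the right-hand side is the limit of `v n = ∑_i (−c choose k−i) RS(i, n)`
  set v : ℕ → ℚ_[p] := fun n ↦
    ∑ i ∈ Finset.range (k + 1), algebraMap ℤ_[p] ℚ_[p] (Ring.choose (-c) (k - i)) * RS i n with hv_def
  have hv : Tendsto v atTop (𝓝 (∑ i ∈ Finset.range (k + 1),
      algebraMap ℤ_[p] ℚ_[p] (Ring.choose (-c) (k - i)) * limUnder atTop (fun n ↦ RS i n))) :=
    tendsto_finsetSum _ fun i _ ↦ (tendsto_riemannSum_of_distribution hRS hdist hC i).const_mul _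
  -- it suffices that `RSz k n − v n → 0`
  suffices hdiff : Tendsto (fun n ↦ RSz k n - v n) atTop (𝓝 0) by
    have := hdiff.add hv
    simpa using this
  have hp1 : (1 : ℝ) < p := by exact_mod_cast (Fact.out : p.Prime).one_lt
  have hbound : ∀ n, ‖RSz k n - v n‖ ≤ C * ((p : ℝ) ^ (-n : ℤ) / ‖((k.factorial : ℕ) : ℚ_[p])‖) := by
    intro n
    haveI : NeZero (p ^ n) := ⟨pow_ne_zero _ (Fact.out : p.Prime).ne_zero⟩
    -- `RSz k n = ∑_{η,s} ν(ηγˢ) ((s − c̄) choose k)` by the translation reindexing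
    have hA : RSz k n = ∑ᶠ η : rootsOfUnity (torsionOrder p) ℤ_[p], ∑ s : ZMod (p ^ n),
        ν (n + cyclotomicExponent p)
            (PadicInt.toZModPow (n + cyclotomicExponent p) ((η : ℤ_[p]ˣ) : ℤ_[p]) *
              (cyclotomicGenerator p : ZMod (p ^ (n + cyclotomicExponent p))) ^ s.val) *
          (((s - PadicInt.toZModPow n c).val.choose k : ℕ) : ℚ_[p]) := by
      rw [hRSz]
      exact finsum_sum_classes_translate (R := ℚ_[p]) n (ν (n + cyclotomicExponent p)) ηz (PadicInt.toZModPow n c)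
        (fun s : ZMod (p ^ n) ↦ ((s.val.choose k : ℕ) : ℚ_[p]))
    -- `v n = ∑_{η,s} ν(ηγˢ) ((−c + s) choose k)` by Vandermonde
    have hB : v n = ∑ᶠ η : rootsOfUnity (torsionOrder p) ℤ_[p], ∑ s : ZMod (p ^ n),
        ν (n + cyclotomicExponent p)
            (PadicInt.toZModPow (n + cyclotomicExponent p) ((η : ℤ_[p]ˣ) : ℤ_[p]) *
              (cyclotomicGenerator p : ZMod (p ^ (n + cyclotomicExponent p))) ^ s.val) *
          algebraMap ℤ_[p] ℚ_[p] (Ring.choose (-c + (s.val : ℤ_[p])) k) := by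
      rw [hv_def]
      dsimp only
      simp only [hRS, finsum_eq_sum_of_fintype, Finset.mul_sum]
      rw [Finset.sum_comm]
      refine Finset.sum_congr rfl fun η _ ↦ ?_
      rw [Finset.sum_comm]
      refine Finset.sum_congr rfl fun s _ ↦ ?_
      rw [← sum_range_choose_mul_natChoose (-c) k s.val, Finset.mul_sum]
      refine Finset.sum_congr rfl fun i _ ↦ ?_
      ring
    rw [hA, hB, finsum_eq_sum_of_fintype, finsum_eq_sum_of_fintype, ← Finset.sum_sub_distrib]
    refine IsUltrametricDist.norm_sum_le_of_forall_le_of_nonneg (by positivity) fun η _ ↦ ?_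
    rw [← Finset.sum_sub_distrib]
    refine IsUltrametricDist.norm_sum_le_of_forall_le_of_nonneg (by positivity) fun s _ ↦ ?_
    rw [← mul_sub, norm_mul]
    refine mul_le_mul (hC _ _) ?_ (norm_nonneg _) hC0
    have hnat : (((s - PadicInt.toZModPow n c).val.choose k : ℕ) : ℚ_[p]) =
        algebraMap ℤ_[p] ℚ_[p] (Ring.choose (((s - PadicInt.toZModPow n c).val : ℕ) : ℤ_[p]) k) := by
      rw [Ring.choose_natCast, map_natCast]
    rw [hnat]
    exact norm_choose_sub_choose_le_of_sub_mem_span k (val_sub_sub_mem_span c n s)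
  have h0 : Tendsto (fun n : ℕ ↦ (p : ℝ) ^ (-n : ℤ)) atTop (𝓝 0) := by
    have h := tendsto_pow_atTop_nhds_zero_of_lt_one (r := ((p : ℝ))⁻¹) (by positivity)
      (inv_lt_one_of_one_lt₀ hp1)
    refine h.congr fun n ↦ ?_
    rw [zpow_neg, zpow_natCast, inv_pow]
  have hK : Tendsto (fun n : ℕ ↦ C * ((p : ℝ) ^ (-n : ℤ) / ‖((k.factorial : ℕ) : ℚ_[p])‖)) atTop (𝓝 0) := by
    simpa using (h0.div_const ‖((k.factorial : ℕ) : ℚ_[p])‖).const_mul C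
  exact squeeze_zero_norm hbound hK

end Literature.NumberTheory.EllipticCurves

end
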